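import Summits.CriticalPhenomena.PercolationContinuityZ3.Theorems.PercNearOneGluingNoHeavyLowerTailSunflowerGradedMerge

/-!
# `NoHeavyLowerTail` (crux stmt-CriticalPhenomena-4575), abstract sunflower cubic: the class 𝓛⁺ (principal leaves) —
# structure, blocker, restriction to a present coordinate

Support file (seat `prim-ineq-prove-1` gen 35; `--supports stmt-CriticalPhenomena-4575`).  No `sorry`, no named facts.
Memo: run/shared/lean/prim/prim-ineq-prove-1/FINDING-LSM-prove1-g35.md §5 (the class 𝒢₁ "with merging").

* `gsafe_of_coord_one` — if `p e = 1` then graded safety of `A` on the block `a ∋ e` follows from graded safety of the section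
  `{ω | insert e ω ∈ A}` on `a.erase e` (a coordinate that is never missing can be removed from the block).
* `LP` — the class 𝓛⁺: PRINCIPAL leaves `⋀_{x ∈ g} x` (`g` a nonempty finite set), conjunctions on disjoint supports, and disjunction
  of a member with one new principal leaf; `supp`, `toSet`, `fam` (the blocker), `leaves`, `WF` (read-once), with the structural facts
  used by the merging induction of the next file: `toSet` is an up-set determined by `supp`; the members of `fam` lie in the support,
  are bad, cover every bad missing set (`fam_cover`), and never contain two elements of one leaf (`fam_sibling`).
-/

noncomputable section

namespace Summit.CriticalPhenomena.PercolationContinuityZ3.Theorems.SunflowerPartition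

namespace SafeCalc

open MeasureTheory Finset
open Literature.Probability.LatticeModels Literature.Probability.Percolation
open TwoGenCore (wmiss)

variable {ι : Type*} [DecidableEq ι] (p : ι → unitInterval)

/-! ## Removing a coordinate that is present almost surely -/

/-- Over a single coordinate with `p e = 1`, a block expectation only sees `T₂ = ∅`. [this work] -/
theorem BEx_single_of_one {e : ι} (hpe : (p e : ℝ) = 1) (G : Finset ι → ℝ) : BEx p {e} G = G ∅ := by
  rw [BEx_single, hpe]; ring

/-- **A coordinate with `p e = 1` can be removed from the block**: graded safety of the section `{ω | insert e ω ∈ A}` on `a.erase e`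
gives graded safety of `A` on `a`. [this work] -/
theorem gsafe_of_coord_one [Fintype ι] (a : Finset ι) {A A' : Set (Set ι)} {e : ι} (he : e ∈ a) (hpe : (p e : ℝ) = 1)
    (hd : DeterminedBy A (↑a : Set ι)) (hd' : DeterminedBy A' (↑(a.erase e) : Set ι)) (hA' : ∀ ω, ω ∈ A' ↔ insert e ω ∈ A)
    (h : GSafe p (a.erase e) A') : GSafe p a A := by
  classical
  intro n c hc hc1 G hanti hle1 hge hgood hbad
  have hsplit : a.erase e ∪ {e} = a := by
    ext x; simp only [mem_union, mem_erase, mem_singleton]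
    constructor
    · rintro (⟨_, hx⟩ | rfl); exacts [hx, he]
    · intro hx; by_cases hxe : x = e; exacts [Or.inr hxe, Or.inl ⟨hxe, hx⟩]
  have hdisj : Disjoint (a.erase e) {e} := disjoint_singleton_right.2 (notMem_erase e a)
  -- block expectations over `a` only see missing sets avoiding `e`
  have hred : ∀ F : Finset ι → ℝ, BEx p a F = BEx p (a.erase e) F := by
    intro F
    conv_lhs => rw [← hsplit]
    rw [BEx_union p hdisj]
    unfold BEx
    refine sum_congr rfl fun T _ => ?_
    congr 1
    beta_reduce
    have := BEx_single_of_one p hpe (fun T₂ => F (T ∪ T₂))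
    unfold BEx at this
    simp only [union_empty] at this
    rw [← this]
  -- the key identity between block points
  have hpt : ∀ T, T ⊆ a.erase e → insert e (((a.erase e) \ T : Finset ι) : Set ι) = ((a \ T : Finset ι) : Set ι) := by
    intro T hT
    ext x
    simp only [Set.mem_insert_iff, Finset.mem_coe, mem_sdiff, mem_erase]
    constructor
    · rintro (rfl | ⟨⟨_, hx⟩, hxT⟩)
      · exact ⟨he, fun hT' => (mem_erase.1 (hT hT')).1 rfl⟩
      · exact ⟨hx, hxT⟩
    · rintro ⟨hx, hxT⟩
      by_cases hxe : x = e
      · exact Or.inl hxe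
      · exact Or.inr ⟨⟨hxe, hx⟩, hxT⟩
  have hsub : ∀ T, T ⊆ a.erase e → T ⊆ a := fun T hT => hT.trans (erase_subset e a)
  have key := h n c hc hc1 G (fun i T T' hTT' hT' => hanti i T T' hTT' (hsub T' hT')) (fun i T hT => hle1 i T (hsub T hT))
    (fun i T hT => hge i T (hsub T hT))
    (fun i T hT hgoodT => hgood i T (hsub T hT) (by rw [← hpt T hT]; exact (hA' _).1 hgoodT))
    (fun T hT hbadT => hbad T (hsub T hT) (fun hTA => hbadT ((hA' _).2 (by rw [hpt T hT]; exact hTA))))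
  have hμ : (prodBernoulli p).real A' = (prodBernoulli p).real A := by
    rw [← BEx_indicator_eq_real p hd, ← BEx_indicator_eq_real p hd', hred]
    unfold BEx
    refine sum_congr rfl fun T hT => ?_
    rw [mem_powerset] at hT
    congr 1
    have : ((a.erase e \ T : Finset ι) : Set ι) ∈ A' ↔ ((a \ T : Finset ι) : Set ι) ∈ A := by rw [hA', hpt T hT]
    simp only [this]
  rw [← hμ]
  calc ∏ i, BEx p a (G i) = ∏ i, BEx p (a.erase e) (G i) := prod_congr rfl fun i _ => hred (G i)
    _ ≤ _ := key

/-! ## The class 𝓛⁺ -/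

/-- The class 𝓛⁺: principal leaves, conjunctions, disjunction with ONE NEW principal leaf. [this work] -/
inductive LP (ι : Type*) : Type _
  | leaf : Finset ι → LP ι
  | and : LP ι → LP ι → LP ι
  | orLeaf : LP ι → Finset ι → LP ι

namespace LP

variable {p}

/-- Support. [this work] -/
def supp : LP ι → Finset ι
  | leaf g => g
  | .and F G => F.supp ∪ G.supp
  | orLeaf F g => F.supp ∪ g

/-- Up-set. [this work] -/
def toSet : LP ι → Set (Set ι)
  | leaf g => {ω | (↑g : Set ι) ⊆ ω}
  | .and F G => F.toSet ∩ G.toSet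
  | orLeaf F g => F.toSet ∪ {ω | (↑g : Set ι) ⊆ ω}

/-- Blocker (minimal bad missing sets). [this work] -/
def fam : LP ι → Finset (Finset ι)
  | leaf g => g.image fun x => {x}
  | .and F G => F.fam ∪ G.fam
  | orLeaf F g => (F.fam ×ˢ g).image fun q => q.1 ∪ {q.2}

/-- The leaves. [this work] -/
def leaves : LP ι → Finset (Finset ι)
  | leaf g => {g}
  | .and F G => F.leaves ∪ G.leaves
  | orLeaf F g => insert g F.leaves

/-- Well-formedness (read-once with nonempty leaves). [this work] -/
def WF : LP ι → Prop
  | leaf g => g.Nonempty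
  | .and F G => F.WF ∧ G.WF ∧ Disjoint F.supp G.supp
  | orLeaf F g => F.WF ∧ g.Nonempty ∧ Disjoint F.supp g

omit [DecidableEq ι] in
/-- Up-sets of 𝓛⁺-formulas are up-sets (for a principal leaf this is `SahiHitting.isUpperSet_cyl`). [this work] -/
theorem isUpperSet_toSet : ∀ F : LP ι, IsUpperSet F.toSet
  | leaf _ => fun _ _ h hg => hg.trans h
  | .and F G => (isUpperSet_toSet F).inter (isUpperSet_toSet G)
  | orLeaf F _ => (isUpperSet_toSet F).union fun _ _ h hg => hg.trans h

/-- A principal leaf is determined by its generator (this is the landed `AdditiveGluingVar975.v975_det_subset`, restated for `LP.leaf` to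
keep the import closure small). [this work] -/
theorem determinedBy_leaf (g : Finset ι) : DeterminedBy (leaf g : LP ι).toSet (↑(leaf g : LP ι).supp : Set ι) := by
  rw [determinedBy_iff]
  intro ω ω' h
  change (↑g : Set ι) ⊆ ω ↔ (↑g : Set ι) ⊆ ω'
  exact ⟨fun hg x hx => ((Set.ext_iff.1 h x).1 ⟨hg hx, hx⟩).1, fun hg x hx => ((Set.ext_iff.1 h x).2 ⟨hg hx, hx⟩).1⟩

/-- Up-sets of 𝓛⁺-formulas are determined by their supports. [this work] -/
theorem determinedBy_toSet : ∀ F : LP ι, DeterminedBy F.toSet (↑F.supp : Set ι)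
  | leaf g => determinedBy_leaf g
  | .and F G => ((determinedBy_toSet F).mono (Finset.coe_subset.2 (subset_union_left (s₂ := G.supp)))).inter
      ((determinedBy_toSet G).mono (Finset.coe_subset.2 (subset_union_right (s₁ := F.supp))))
  | orLeaf F g => by
    have hF := (determinedBy_toSet F).mono (Finset.coe_subset.2 (subset_union_left (s₁ := F.supp) (s₂ := g)))
    have hG := (determinedBy_leaf g).mono (Finset.coe_subset.2 (subset_union_right (s₁ := F.supp) (s₂ := g)))
    rw [determinedBy_iff] at hF hG ⊢
    intro ω ω' h
    exact or_congr (hF ω ω' h) (hG ω ω' h)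

/-- Leaves lie in the support. [this work] -/
theorem leaves_subset_supp : ∀ F : LP ι, ∀ g ∈ F.leaves, g ⊆ F.supp
  | leaf g, g', h => by rw [leaves, mem_singleton] at h; rw [h]; exact subset_rfl
  | .and F G, g', h => by
    rw [leaves, mem_union] at h
    rcases h with h | h
    · exact (leaves_subset_supp F g' h).trans subset_union_left
    · exact (leaves_subset_supp G g' h).trans subset_union_right
  | orLeaf F g, g', h => by
    rw [leaves, mem_insert] at h
    rcases h with rfl | h
    · exact subset_union_right
    · exact (leaves_subset_supp F g' h).trans subset_union_left

/-- Members of the blocker lie in the support. [this work] -/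
theorem fam_subset_supp : ∀ F : LP ι, ∀ C ∈ F.fam, C ⊆ F.supp
  | leaf g, C, h => by
    rw [fam, mem_image] at h
    obtain ⟨x, hx, rfl⟩ := h
    exact singleton_subset_iff.2 hx
  | .and F G, C, h => by
    rw [fam, mem_union] at h
    rcases h with h | h
    · exact (fam_subset_supp F C h).trans subset_union_left
    · exact (fam_subset_supp G C h).trans subset_union_right
  | orLeaf F g, C, h => by
    rw [fam, mem_image] at h
    obtain ⟨⟨C', x⟩, hq, rfl⟩ := h
    rw [mem_product] at hq
    exact union_subset_union (fam_subset_supp F C' hq.1) (singleton_subset_iff.2 hq.2)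

/-- Members of the blocker are bad. [this work] -/
theorem fam_bad : ∀ F : LP ι, F.WF → ∀ C ∈ F.fam, ((F.supp \ C : Finset ι) : Set ι) ∉ F.toSet
  | leaf g, _, C, h => by
    rw [fam, mem_image] at h
    obtain ⟨x, hx, rfl⟩ := h
    intro hmem
    have := hmem (Finset.mem_coe.2 hx)
    rw [Finset.mem_coe, supp, mem_sdiff, mem_singleton] at this
    exact this.2 rfl
  | .and F G, h, C, hC => by
    rw [fam, mem_union] at hC
    rcases hC with hC | hC
    · intro hmem
      have h1 := (mem_iff_of_determinedBy (b := G.supp) (determinedBy_toSet F)).1 hmem.1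
      rw [inter_eq_left.2 (fam_subset_supp F C hC)] at h1
      exact fam_bad F h.1 C hC h1
    · intro hmem
      have h1 := (mem_iff_of_determinedBy (b := F.supp) (determinedBy_toSet G)).1
        (by rw [supp, union_comm] at hmem; exact hmem.2)
      rw [inter_eq_left.2 (fam_subset_supp G C hC)] at h1
      exact fam_bad G h.2.1 C hC h1
  | orLeaf F g, h, C, hC => by
    rw [fam, mem_image] at hC
    obtain ⟨⟨C', x⟩, hq, rfl⟩ := hC
    rw [mem_product] at hq
    have hxF : x ∉ F.supp := fun hx => Finset.disjoint_left.1 h.2.2 hx hq.2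
    rintro (hmem | hmem)
    · have h1 := (mem_iff_of_determinedBy (b := g) (determinedBy_toSet F)).1 hmem
      have : (C' ∪ {x}) ∩ F.supp = C' := by
        ext y; simp only [mem_inter, mem_union, mem_singleton]
        constructor
        · rintro ⟨hy | rfl, hy'⟩; exacts [hy, absurd hy' hxF]
        · intro hy; exact ⟨Or.inl hy, fam_subset_supp F C' hq.1 hy⟩
      rw [this] at h1
      exact fam_bad F h.1 C' hq.1 h1
    · have := hmem (Finset.mem_coe.2 hq.2)
      rw [Finset.mem_coe, mem_sdiff] at this
      exact this.2 (mem_union_right _ (mem_singleton_self x))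

/-- The blocker covers every bad missing set. [this work] -/
theorem fam_cover : ∀ F : LP ι, F.WF → ∀ T, T ⊆ F.supp → ((F.supp \ T : Finset ι) : Set ι) ∉ F.toSet → ∃ C ∈ F.fam, C ⊆ T
  | leaf g, _, T, hT, hbad => by
    have : ¬ (↑g : Set ι) ⊆ ((g \ T : Finset ι) : Set ι) := hbad
    rw [Finset.coe_subset] at this
    obtain ⟨x, hxg, hxT⟩ := not_subset.1 this
    rw [mem_sdiff, not_and, not_not] at hxT
    exact ⟨{x}, mem_image_of_mem _ hxg, singleton_subset_iff.2 (hxT hxg)⟩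
  | .and F G, h, T, hT, hbad => by
    rw [toSet, Set.mem_inter_iff, not_and_or] at hbad
    rcases hbad with hA | hB
    · have h1 : ((F.supp \ (T ∩ F.supp) : Finset ι) : Set ι) ∉ F.toSet := fun h' =>
        hA ((mem_iff_of_determinedBy (b := G.supp) (determinedBy_toSet F)).2 h')
      obtain ⟨C, hC, hCT⟩ := fam_cover F h.1 _ inter_subset_right h1
      exact ⟨C, mem_union_left _ hC, hCT.trans inter_subset_left⟩
    · have h1 : ((G.supp \ (T ∩ G.supp) : Finset ι) : Set ι) ∉ G.toSet := fun h' =>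
        hB (by rw [supp, union_comm]; exact (mem_iff_of_determinedBy (b := F.supp) (determinedBy_toSet G)).2 h')
      obtain ⟨C, hC, hCT⟩ := fam_cover G h.2.1 _ inter_subset_right h1
      exact ⟨C, mem_union_right _ hC, hCT.trans inter_subset_left⟩
  | orLeaf F g, h, T, hT, hbad => by
    rw [toSet, Set.mem_union, not_or] at hbad
    obtain ⟨hA, hg⟩ := hbad
    have hg' : ¬ (↑g : Set ι) ⊆ (((F.supp ∪ g) \ T : Finset ι) : Set ι) := hg
    rw [Finset.coe_subset] at hg'
    obtain ⟨x, hxg, hxT⟩ := not_subset.1 hg'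
    rw [mem_sdiff, not_and, not_not] at hxT
    have hxT' : x ∈ T := hxT (mem_union_right _ hxg)
    have h1 : ((F.supp \ (T ∩ F.supp) : Finset ι) : Set ι) ∉ F.toSet := fun h' =>
      hA ((mem_iff_of_determinedBy (b := g) (determinedBy_toSet F)).2 h')
    obtain ⟨C, hC, hCT⟩ := fam_cover F h.1 _ inter_subset_right h1
    refine ⟨C ∪ {x}, mem_image.2 ⟨⟨C, x⟩, mem_product.2 ⟨hC, hxg⟩, rfl⟩, ?_⟩
    exact union_subset (hCT.trans inter_subset_left) (singleton_subset_iff.2 hxT')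

/-- No member of the blocker contains two elements of one leaf (siblings). [this work] -/
theorem fam_sibling : ∀ F : LP ι, F.WF → ∀ g₀ ∈ F.leaves, ∀ e e' : ι, e ∈ g₀ → e' ∈ g₀ → e ≠ e' →
    ∀ C ∈ F.fam, ¬ (e ∈ C ∧ e' ∈ C)
  | leaf g, _, g₀, _, e, e', _, _, hne, C, hC => by
    rw [fam, mem_image] at hC
    obtain ⟨x, _, rfl⟩ := hC
    rintro ⟨h1, h2⟩
    rw [mem_singleton] at h1 h2
    exact hne (h1.trans h2.symm)
  | .and F G, h, g₀, hg₀, e, e', he, he', hne, C, hC => by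
    rw [leaves, mem_union] at hg₀
    rw [fam, mem_union] at hC
    rcases hg₀ with hg₀ | hg₀ <;> rcases hC with hC | hC
    · exact fam_sibling F h.1 g₀ hg₀ e e' he he' hne C hC
    · rintro ⟨h1, _⟩
      exact Finset.disjoint_left.1 h.2.2 (leaves_subset_supp F g₀ hg₀ he) (fam_subset_supp G C hC h1)
    · rintro ⟨h1, _⟩
      exact Finset.disjoint_right.1 h.2.2 (leaves_subset_supp G g₀ hg₀ he) (fam_subset_supp F C hC h1)
    · exact fam_sibling G h.2.1 g₀ hg₀ e e' he he' hne C hC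
  | orLeaf F g, h, g₀, hg₀, e, e', he, he', hne, C, hC => by
    rw [fam, mem_image] at hC
    obtain ⟨⟨C', x⟩, hq, rfl⟩ := hC
    rw [mem_product] at hq
    rw [leaves, mem_insert] at hg₀
    rintro ⟨h1, h2⟩
    rcases hg₀ with rfl | hg₀
    · -- both in the new leaf: they avoid C' ⊆ F.supp, so both equal x
      have hC'g : ∀ y ∈ g₀, y ∉ C' := fun y hy hyC => Finset.disjoint_right.1 h.2.2 hy (fam_subset_supp F C' hq.1 hyC)
      rw [mem_union, mem_singleton] at h1 h2
      rcases h1 with h1 | rfl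
      · exact hC'g e he h1
      rcases h2 with h2 | h2
      · exact hC'g e' he' h2
      · exact hne h2.symm
    · have hxg : ∀ y ∈ g₀, y ≠ x := fun y hy hyx =>
        Finset.disjoint_left.1 h.2.2 (leaves_subset_supp F g₀ hg₀ hy) (hyx ▸ hq.2)
      rw [mem_union, mem_singleton] at h1 h2
      rcases h1 with h1 | h1
      · rcases h2 with h2 | h2
        · exact fam_sibling F h.1 g₀ hg₀ e e' he he' hne C' hq.1 ⟨h1, h2⟩
        · exact hxg e' he' h2
      · exact hxg e he h1

end LP

end SafeCalc

end Summit.CriticalPhenomena.PercolationContinuityZ3.Theorems.SunflowerPartition
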